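import Literature.NumberTheory.EllipticCurves.Kato2004.EulerSystemBoundFineSelmer
import HarnessLib

/-!
# Kato 2004 (Astérisque 295) Thm. 13.4 (2)(3) for `T = T_pW`, odd `p` — the PRINT-EXACT reading on the
# pinned `(𝐇¹_Γ(T_pW), X₀(W/ℚ_∞))`: the dual fine Selmer group with its CONTRAGREDIENT `Λ`-structure
# (`FB : W.FineSelmerDualData κ γ⁻¹` against `I : IwasawaH1Data W p κ γ`, SAME prime `𝔭` on both sides)

Topic `NumberTheory/EllipticCurves`, sub-directory `Kato2004` (namespace = path). Sibling of
`EulerSystemBoundFineSelmer` (cell `bsd-potss`), whose vocabulary (`IsEulerSystemClass`, the pinned data)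
is used unchanged, and the odd-`p` twin of `EulerSystemBoundFineSelmerTwoContragredient` (the same retype
at `p = 2`), whose module docstring carries the convention derivation (reading flag
`Kato-134-dual-action`) and the verbatim sources; they are not repeated at length here. THIS FILE: ONE
named fact (`def … : Prop`, D-0014; nothing asserted, no `_holds`); no instance, no notation, no attribute.
Typed by a Literature typer (cell `bsd-stepL`, guest service) following the convention audit of the cell
`bsd-wall` (`Cruxes/SignedKatoDivisibilityUpToAtTwo/G4-CONVENTION-AUDIT.md` §0–§1 and §3 (b): "the
existing named fact `Kato2004.thm13_4_two_…` (and the odd-p `thm13_4_…` …) deserve the same audit by a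
typer: as typed they are print ∘ ι"; second reader `W3G2-READER-G4-AUDIT.md`: "same for the odd-p
sibling"). HONEST FRAMING: a TRANSCRIPTION; Kato's theorem is not proved here; BSD is not proved by any
of this; nothing is booked.

## The point (summary; details in the `p = 2` twin)

Kato's `𝐇¹(T)`, `𝐇²(T)₀` are `Λ = O_L[[G_∞]]`-modules through the natural action of `G_∞` [§12.2,
p. 220], and Thm. 13.4 (2)(3) compare `𝐇²(T)₀` with `Λ/J` at the SAME prime `𝔭`. The tree's
`I : IwasawaH1Data W p κ γ` has `T` acting as `conj_γ − 1` (covariant, `1 + T ↦ γ`;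
`IwasawaH1Data.proj_T_smul`); the tree's `FB : W.FineSelmerDualData κ γ'` has `T` acting on
`Hom(Sel₀(ℚ_∞, E[p^∞]), ℚ/ℤ)` by PRE-composition with `conj_{γ'}` (`FineSelmerDualData.toDual_T_smul`).
Poitou–Tate duality [Kato (14.9.1)–(14.9.3), p. 239; (17.13.1), p. 279, "a sequence of `Λ`-modules"] is
functorial in the pair (Galois group, module), hence invariant under transport of structure by
`σ ∈ Gal(ℚ̄/ℚ)`, so it carries the natural action on `𝐇²(T)₀` to the CONTRAGREDIENT action
`x ↦ x ∘ conj_{σ⁻¹}` on the Pontryagin dual; with `1 + T ↦ γ` on both sides Kato's `𝐇²(T)₀` is the datum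
`FB : W.FineSelmerDualData κ γ⁻¹`. The sibling takes `γ` there, i.e. `(X₀)^ι` in Greenberg's notation
("`S^ι` … the `Λ`-module with the same underlying set as `S` but with `Λ` acting through `ι`",
`ι(γ) = γ⁻¹` [Greenberg1989, pp. 101–102]), and so transcribes `ℓ_{ι𝔭}(X₀) ≤ ℓ_𝔭(𝐇¹/Λs)` = print ∘ `ι`
on one side; the two transcriptions differ by the unprinted statement «`char_Λ(𝐇¹(T_pW)/Λs)` is
`ι`-symmetric prime by prime». The sibling is NOT edited (D-0014); this file vendors the print-exact
reading under a new name. All other reading flags (`Kato-134-levels`, `Kato-134-i-Delta-trivial`,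
`Kato-134-H20-fine`, `Kato-134-J-quotient`) are the sibling's, VERBATIM.

## Source, verbatim (K. Kato, Astérisque 295 (2004), held copy `paper:url-37fbba0bb64a`, PDF page =
## printed page − 115; Thm. 13.4 is quoted in full in the sibling's module docstring)

**Thm. 13.4** (p. 226): "(2) Let `𝔭` be a prime ideal of `Λ` of height one which does not contain `p`.
Then `length_{Λ_𝔭}(𝐇²(T)_{0,𝔭}) ≤ length_{Λ_𝔭}(Λ_𝔭/J_𝔭)`. (3) Assume that there exists an element `σ` of
`Gal(ℚ̄/ℚ(ζ_{p^∞}))` such that `Coker(1 − σ : T → T)` is a free `O_L`-module of rank `1`, and assume that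
`T ⊗_{O_L} O_L/m_L` is irreducible as a representation of `Gal(ℚ̄/ℚ)` over `O_L/m_L`. Assume further
`p ≠ 2`. Then `length_{Λ_𝔭}(𝐇²(T)_{0,𝔭}) ≤ length_{Λ_𝔭}(Λ_𝔭/J_𝔭)` for any prime ideal `𝔭` of `Λ` of
height one." §12.2 (p. 220): "`𝐇¹(T)` and `𝐇²(T)` are finitely generated `ℤ_p[[G_∞]]`-modules."
§17.13 (p. 279): "we obtain a sequence of `Λ`-modules (17.13.1) `… → X(T^*(1 − k)) → 𝐇²(T(k)) →
𝐇²_loc(T(k))`".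

## What is NOT here (and why)

* NO edit of the sibling; NO claim that the sibling and the present fact are equivalent; nothing else of
  Thm. 13.4 beyond the sibling's clauses (2)(3); NO `_holds` (size XL).
-- TODO(general form): as in the sibling (arbitrary lattices `T` as in 13.1, all `Δ`-components,
-- non-cyclic `Z`).

References: [Kato2004Asterisque] §12.2 (p. 220), Thm. 13.4 (2)(3) (p. 226), §13.1, Ex. 13.3
(pp. 224–225), §14.9 (14.9.1)–(14.9.3) (p. 239), §17.13 (17.13.1) (p. 279); [Greenberg1989] §0
pp. 101–102 (`S^ι`, Thm. 2); [GreenbergLNM1716] §1 p. 60, Thm. 1.14 (p. 68); tree: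
`Kato2004/EulerSystemBoundFineSelmer.lean` (sibling), `Kato2004/EulerSystemBoundFineSelmerTwoContragredient.lean`
(`p = 2` twin, flag `Kato-134-dual-action`), `Kato2004/IwasawaCohomology.lean`, `KatoFineSelmerDual.lean`,
`IwasawaAlgebraInvolution.lean`.
-/

noncomputable section

open scoped NumberField
open Field
open Literature.NumberTheory.GaloisRepresentations
open Literature.NumberTheory.EllipticCurves Literature.NumberTheory.EllipticCurves.Kato2004.EulerSystemValues

namespace Literature.NumberTheory.EllipticCurves.Kato2004

/-- **Kato 2004, Thm. 13.4 (2)(3) for `T = T_pW`, odd `p`, PRINT-EXACT on the pinned data: the dual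
fine Selmer group with its CONTRAGREDIENT `Λ`-structure.** For every elliptic curve `W/ℚ` (ANY
reduction at `p`; structure facts of `T_pW` as instance BINDERS), every odd prime `p`, the cyclotomic
`ℤ_p`-extension `κ` with topological generator `γ`, every pinned `I : IwasawaH1Data W p κ γ`
(`𝐇¹_Γ(T_pW)`, `T = conj_γ − 1`, covariant: `1 + T ↦ γ`) and `FB : W.FineSelmerDualData κ γ⁻¹`
(`X₀(W/ℚ_∞) = Hom(Sel₀(ℚ_∞, E[p^∞]), ℚ_p/ℤ_p)` with `T` acting as `x ↦ x ∘ conj_{γ⁻¹} − x`, the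
contragredient action of `γ` minus one — the structure Poitou–Tate duality carries to Kato's natural
action on `𝐇²(T)₀`), every GENUINE Λ-adic Euler-system class `s ∈ 𝐇¹_Γ(T_pW)` (`IsEulerSystemClass`)
with `s ≠ 0`, and Kato's hypothesis (v) for `T_pW`:
* (2) at every height-one prime `𝔭 ∌ p` of `Λ = ℤ_p⟦X⟧`: `ℓ_𝔭(X₀(W/ℚ_∞)) ≤ ℓ_𝔭(𝐇¹_Γ(T_pW)/Λs)`;
* (3) if `W[p]` is irreducible and some `σ ∈ Gal(ℚ̄/ℚ(ζ_{p^∞}))` has `Coker(ρ(σ) − 1)` free of rank one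
  over `ℤ_p`, the same inequality at EVERY height-one prime `𝔭`
— both sides at the SAME `𝔭`, as printed. VERBATIM the sibling
`thm13_4_lengthAt_fineSelmerDual_le_of_isEulerSystemClass` except for the generator argument `γ⁻¹` of the
fine dual datum (the sibling, with `γ` there, reads `ℓ_{ι𝔭}(X₀) ≤ ℓ_𝔭(𝐇¹/Λs)` = print ∘ `ι` on one side;
the two differ by an unprinted `ι`-symmetry of `char(𝐇¹/Λs)`). Named fact; nothing asserted; no
`_holds` (size XL); flags of the sibling and `Kato-134-dual-action` of the `p = 2` twin apply verbatim.
[cite: Kato2004Asterisque, Thm. 13.4 (2)(3) (p. 226), §12.2 (12.2.1) (p. 220), §13.1 and Ex. 13.3 (pp. 224–225), Prop. 13.7 (p. 227), §14.9 (14.9.1)–(14.9.3) (p. 239), §17.13 (17.13.1) (p. 279)]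
[cite: Greenberg1989, §0 pp. 101–102 (the Λ-module S^ι, ι(γ) = γ⁻¹, and Thm. 2)]
[cite: GreenbergLNM1716, §1 p. 60 and Thm. 1.14 (p. 68)] -/
def thm13_4_lengthAt_fineSelmerDualContra_le_of_isEulerSystemClass : Prop :=
  ∀ (W : WeierstrassCurve ℚ) [W.IsElliptic] (p : ℕ) [Fact p.Prime]
    [ContinuousSMul ℤ_[p] (W.tateModule p)] [Module.Free ℤ_[p] (W.tateModule p)]
    [Module.Finite ℤ_[p] (W.tateModule p)]
    (κ : ZpExtension ℚ p) (γ : absoluteGaloisGroup ℚ),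
    p ≠ 2 → κ.IsCyclotomic → κ.IsTopGenerator γ →
  ∀ (I : IwasawaH1Data W p κ γ) (FB : W.FineSelmerDualData κ γ⁻¹) (s : I.H),
    IsEulerSystemClass W p κ γ I s → s ≠ 0 →
    -- hypothesis (v) of Thm. 13.4 for `T = T_pW`
    (∃ σ : absoluteGaloisGroup ℚ,
      (∀ (n : ℕ) (t : AlgebraicClosure ℚ), t ^ p ^ n = 1 → σ • t = t) ∧
        Module.finrank ℤ_[p]
          ((W.tateModule p) ⧸ LinearMap.range (W.galoisRepTate p σ - 1)) = 1) →
    -- (2): at the height-one primes `𝔭 ∌ p`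
    (∀ 𝔭 : PrimeSpectrum (IwasawaAlgebra p), 𝔭.asIdeal.height = 1 →
      PowerSeries.C (p : ℤ_[p]) ∉ 𝔭.asIdeal →
        Module.lengthAt (IwasawaAlgebra p) FB.X 𝔭 ≤
          Module.lengthAt (IwasawaAlgebra p) (I.H ⧸ Submodule.span (IwasawaAlgebra p) {s}) 𝔭) ∧
    -- (3): under `W[p]` irreducible and a `σ` with `Coker(ρ σ − 1)` free of rank one, at EVERY
    -- height-one prime
    (W.HasIrreducibleModPGaloisRep p →
      (∃ σ : absoluteGaloisGroup ℚ,
        (∀ (n : ℕ) (t : AlgebraicClosure ℚ), t ^ p ^ n = 1 → σ • t = t) ∧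
          Nonempty (((W.tateModule p) ⧸ LinearMap.range (W.galoisRepTate p σ - 1)) ≃ₗ[ℤ_[p]]
            ℤ_[p])) →
      ∀ 𝔭 : PrimeSpectrum (IwasawaAlgebra p), 𝔭.asIdeal.height = 1 →
        Module.lengthAt (IwasawaAlgebra p) FB.X 𝔭 ≤
          Module.lengthAt (IwasawaAlgebra p) (I.H ⧸ Submodule.span (IwasawaAlgebra p) {s}) 𝔭)

end Literature.NumberTheory.EllipticCurves.Kato2004

end
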